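import Summits.QuantumAdvantage.QuantumAdvantage.Theorems.LinnikCubicClassGroupsDegreeOnePrimesEscapeDeuringSmoothedCore
import Summits.QuantumAdvantage.QuantumAdvantage.Theorems.LinnikCubicClassGroupsDegreeOnePrimesEscapeDeuringAllBasePrelims
import HarnessLib

/-!
# The Deuring-twisted smoothed explicit formula of a cyclic `N|E`: the core estimate, for EVERY base field `E`

Topic `Summits/QuantumAdvantage/QuantumAdvantage/Theorems`, cell B2b-1 (linnik-cubic), PART A (gen 13); helper
toward the crux `DegreeOnePrimesEscape` (stmt-QuantumAdvantage-11543) — the LMO chain for conjugacy classes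
WITHOUT the restriction `1 < [E:ℚ]` (so that `E = ℚ`, i.e. `σ` generating `Gal(N/ℚ)`, is allowed).
HONEST FRAMING: the value of this file is a THEOREM (kernel-checked) — NOT summit progress.

`deuringSum_core_all` is `deuringSum_core` (`…DeuringSmoothedCore.lean`, gen 12) verbatim, except that the two
`ζ₁_E`-terms are bounded by `famMult_zero_term_le_all` / `leftLine_term_le_one_all`
(`…DeuringAllBasePrelims.lean`), which do not need `condQn E ≥ 12`.
References: [LagariasMontgomeryOdlyzko1979, §§3, 7]; [ThornerZaman2019, Thm. 1.4, §5]; [Weiss1983].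
-/

noncomputable section

open Complex Real MeasureTheory Set Filter Topology NumberField NumberField.InfinitePlace IsDedekindDomain
open scoped NumberField nonZeroDivisors

namespace Summit.QuantumAdvantage.QuantumAdvantage.Theorems.DegreeOnePrimesEscape

open Literature.NumberTheory.LFunctions Literature.NumberTheory.LFunctions.NumberField
  Literature.NumberTheory.LFunctions.EntireEF Literature.NumberTheory.LFunctions.TZWeight
  Literature.NumberTheory.LFunctions.AbelianDensity

/-! ### The core estimate -/

set_option maxHeartbeats 6400000 in
/-- **The core estimate of the Deuring-twisted smoothed explicit formula at one `x ≥ Q^{a₁}`, for EVERY base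
field `E` (no hypothesis `1 < [E:ℚ]`; otherwise verbatim `deuringSum_core`)** (cf.
`smoothedClassSum_dichotomy_dh`, step `hcore`): given finite exceptional sets `Exc j` (zeros of `ζ₁_E` for
`j = 0`, of `L_j` for `0 < j < m`) containing every zero of `ζ₁_N` in the exceptional segment, and a zero-free
constant `c_Z` off the segment for the class-group family of `N`, the combined character sum satisfies
`‖Σ_{j<m} c^j K_j(g_x) − F(−1) + Σ_j c^j Σ_{ρ ∈ Exc j} m_j(ρ) F(−ρ)‖ ≤ x A₁ (e^{−c_Z L/(4a log Q)} + e^{−√(c_Z L/4)}) + (η/4) x c₁ Q^{−2}`.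
[cite: LagariasMontgomeryOdlyzko1979, §7] [cite: ThornerZaman2019, §5] -/
theorem deuringSum_core_all (n₀ : ℕ) (hn₀ : 1 < n₀) {b D a : ℝ} {η : ℝ} (hη : 0 < η)
    {ν a₀ A₀ : ℝ} (hν0 : 0 < ν) (hν64 : ν ≤ 1 / 64) (hA₀ : 0 < A₀) {c : ℝ}
    (hZ : ∀ (K : Type) [Field K] [NumberField K], Module.finrank ℚ K = n₀ →
      (∀ (T : ℝ), 1 ≤ T → ∀ u : AddChar (Additive (ClassGroup (𝓞 K))) ℂ → Finset ℂ,
        (∀ ψ, ∀ ρ ∈ u ψ, famF K ψ ρ = 0 ∧ 1 / 4 ≤ ρ.re ∧ ρ.re < 1 ∧ |ρ.im| ≤ T) →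
        ∀ α : ℝ, α ≤ 1 →
          ∑ ψ, ∑ ρ ∈ u ψ with α ≤ ρ.re, (famMult K ψ ρ : ℝ) ≤
            D * Real.exp (b * (a * Real.log (ThornerZaman.condQn K) + Real.log (T + 4))) ^ (1 - α)) →
      ∀ x : ℝ, ThornerZaman.condQn K ^ a₀ ≤ x → ∀ c_Z : ℝ, 0 < c_Z →
      (∀ (ψ : AddChar (Additive (ClassGroup (𝓞 K))) ℂ) (ρ : ℂ), famF K ψ ρ = 0 → 1 / 4 ≤ ρ.re →
        ρ.re < 1 → |ρ.im| ≤ x → ¬ excRegion c K ρ →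
          ρ.re ≤ 1 - c_Z / (a * Real.log (ThornerZaman.condQn K) + Real.log (|ρ.im| + 4))) →
      ∀ ε : ℝ, x ^ (-ν) ≤ ε → ε ≤ 1 →
      ∀ u : AddChar (Additive (ClassGroup (𝓞 K))) ℂ → Finset ℂ,
        (∀ ψ, ∀ ρ ∈ u ψ, famF K ψ ρ = 0 ∧ 0 < ρ.re ∧ ρ.re < 1) →
        ∑ ψ, ∑ ρ ∈ u ψ with ¬ excRegion c K ρ,
            (famMult K ψ ρ : ℝ) * ‖fordLaplace (tzTest (Real.log x) ε) (-ρ)‖ ≤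
          A₀ * x * (Real.exp (-(c_Z * Real.log x / (4 * a * Real.log (ThornerZaman.condQn K)))) +
              Real.exp (-Real.sqrt (c_Z * Real.log x / 4))) + A₀ * x ^ (1 - ν))
    {c₁ : ℝ} (hc₁ : 0 < c₁)
    {Al Cr M CJ : ℝ} (hAl0 : 0 < Al)
    (hAl : ∀ (K : Type) [Field K] [NumberField K] (χ : ClassGroup (𝓞 K) →* ℂˣ) (t : ℝ),
      ‖logDeriv (classGroupLFunction K χ) (-1 / 2 + t * I)‖ ≤
        Al * (Module.finrank ℚ K + 1) * (Real.log ((NumberField.discr K).natAbs : ℝ) + Real.log (|t| + 4)))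
    (hCr0 : 0 < Cr)
    (hCr : ∀ (K : Type) [Field K] [NumberField K] (𝔪 : Ideal (𝓞 K))
      (ψ : HeightOneSpectrum (𝓞 K) → ℂ) (p : Finset {w : InfinitePlace K // IsReal w}),
      IsRayClassCharacter 𝔪 ψ → IsPrimitive 𝔪 ψ → IsSignType 𝔪 ψ p → 𝔪 ≠ ⊥ →
      ∀ (L L' : ℂ → ℂ), Differentiable ℂ L → (∀ s : ℂ, 1 < s.re → L s = rayClassLSeries 𝔪 ψ s) →
        Differentiable ℂ L' → (∀ s : ℂ, 1 < s.re → L' s = rayClassLSeries 𝔪 (star ψ) s) →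
      ∀ t : ℝ, ‖logDeriv L (-1 / 2 + t * I)‖ ≤
        Cr * (Module.finrank ℚ K + 1) * (Real.log (|(discr K : ℝ)| * (Ideal.absNorm 𝔪 : ℝ)) + Real.log (|t| + 4)))
    (hM : ∀ y : ℝ, |iteratedDeriv 1 Real.smoothTransition y| ≤ M ∧ |iteratedDeriv 2 Real.smoothTransition y| ≤ M)
    (hCJ0 : 0 ≤ CJ) (hCJAl : 8 * leftLineConst * Al * (n₀ + 1) * M ≤ CJ) (hCJCr : 8 * leftLineConst * Cr * (n₀ + 1) * M ≤ CJ)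
    {a₁ : ℝ} (ha₁a₀ : a₀ ≤ a₁) (ha₁32 : 32 ≤ a₁)
    (ha₁J : (2 + max 0 (Real.log (4 * (n₀ * A₀ + 1152 + CJ) / (η * c₁)))) / ν ≤ a₁)
    (E N : Type) [Field E] [NumberField E] [Field N] [NumberField N] [Algebra E N]
    (hNn : Module.finrank ℚ N = n₀)
    (hdens : ∀ (T : ℝ), 1 ≤ T → ∀ u : AddChar (Additive (ClassGroup (𝓞 N))) ℂ → Finset ℂ,
        (∀ ψ, ∀ ρ ∈ u ψ, famF N ψ ρ = 0 ∧ 1 / 4 ≤ ρ.re ∧ ρ.re < 1 ∧ |ρ.im| ≤ T) →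
        ∀ α : ℝ, α ≤ 1 →
          ∑ ψ, ∑ ρ ∈ u ψ with α ≤ ρ.re, (famMult N ψ ρ : ℝ) ≤
            D * Real.exp (b * (a * Real.log (ThornerZaman.condQn N) + Real.log (T + 4))) ^ (1 - α))
    (m : ℕ) (hm1 : 1 ≤ m)
    (𝔣 : ℕ → Ideal (𝓞 E)) (χ : ℕ → HeightOneSpectrum (𝓞 E) → ℂ)
    (p : ℕ → Finset {w : InfinitePlace E // w.IsReal}) (L L' : ℕ → ℂ → ℂ)
    (hdata : ∀ j, 𝔣 j ≠ ⊥ ∧ IsRayClassCharacter (𝔣 j) (χ j) ∧ IsPrimitive (𝔣 j) (χ j) ∧ IsSignType (𝔣 j) (χ j) (p j))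
    (hnt : ∀ j ∈ Finset.Ico 1 m, ∃ v : HeightOneSpectrum (𝓞 E), ¬ 𝔣 j ≤ v.asIdeal ∧ χ j v ≠ 1)
    (hL : ∀ j ∈ Finset.Ico 1 m, Differentiable ℂ (L j) ∧ ∀ s : ℂ, 1 < s.re → L j s = rayClassLSeries (𝔣 j) (χ j) s)
    (hL' : ∀ j ∈ Finset.Ico 1 m, Differentiable ℂ (L' j) ∧
      ∀ s : ℂ, 1 < s.re → L' j s = rayClassLSeries (𝔣 j) (star (χ j)) s)
    (hord : ∀ ρ : ℂ, analyticOrderNatAt (dedekindZeta₁ N) ρ =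
        analyticOrderNatAt (dedekindZeta₁ E) ρ + ∑ j ∈ Finset.Ico 1 m, analyticOrderNatAt (L j) ρ)
    (h𝔣0 : 𝔣 0 = ⊤) (hχ0 : ∀ v, χ 0 v = 1)
    (hcond : ∀ j ∈ Finset.Ico 1 m, |(NumberField.discr E : ℝ)| * (Ideal.absNorm (𝔣 j) : ℝ) ≤ (NumberField.discr N).natAbs)
    (hdE : ((NumberField.discr E).natAbs : ℝ) ≤ (NumberField.discr N).natAbs)
    (hnEn₀ : (Module.finrank ℚ E : ℝ) ≤ n₀) (hmn₀ : (m : ℝ) ≤ n₀)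
    (x : ℝ) (hx : ThornerZaman.condQn N ^ a₁ ≤ x) (cc : ℂ) (hcc : ‖cc‖ ≤ 1) (Exc : ℕ → Finset ℂ)
    (hExc0 : ∀ ρ ∈ Exc 0, famF E 0 ρ = 0 ∧ 0 < ρ.re ∧ ρ.re < 1)
    (hExcj : ∀ j ∈ Finset.Ico 1 m, ∀ ρ ∈ Exc j, L j ρ = 0 ∧ 0 < ρ.re ∧ ρ.re < 1)
    (hExc' : ∀ ρ, dedekindZeta₁ N ρ = 0 → 0 < ρ.re → ρ.re < 1 → excRegion c N ρ →
        (famF E 0 ρ = 0 → ρ ∈ Exc 0) ∧ ∀ j ∈ Finset.Ico 1 m, L j ρ = 0 → ρ ∈ Exc j)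
    (cZ : ℝ) (hcZ : 0 < cZ)
    (hzfr : ∀ (ψ : AddChar (Additive (ClassGroup (𝓞 N))) ℂ) (ρ : ℂ), famF N ψ ρ = 0 → 1 / 4 ≤ ρ.re →
        ρ.re < 1 → |ρ.im| ≤ x → ¬ excRegion c N ρ →
          ρ.re ≤ 1 - cZ / (a * Real.log (ThornerZaman.condQn N) + Real.log (|ρ.im| + 4))) :
    ‖∑ j ∈ Finset.range m, cc ^ j * coefFordK (rcCoef (𝔣 j) (χ j)) (tzTest (Real.log x) (x ^ (-ν))) 0 -
        fordLaplace (tzTest (Real.log x) (x ^ (-ν))) (-1) +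
        (∑ ρ ∈ Exc 0, (famMult E 0 ρ : ℂ) * fordLaplace (tzTest (Real.log x) (x ^ (-ν))) (-ρ) +
          ∑ j ∈ Finset.Ico 1 m, cc ^ j *
            ∑ ρ ∈ Exc j, (analyticOrderNatAt (L j) ρ : ℂ) * fordLaplace (tzTest (Real.log x) (x ^ (-ν))) (-ρ))‖ ≤
      x * ((n₀ * A₀) * (Real.exp (-(cZ * Real.log x / (4 * a * Real.log (ThornerZaman.condQn N)))) +
        Real.exp (-Real.sqrt (cZ * Real.log x / 4)))) + η / 4 * x * (c₁ * ThornerZaman.condQn N ^ (-(2 : ℝ))) := by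
  classical
  have hlC := leftLineConst_nonneg
  have hM0 : 0 ≤ M := le_trans (abs_nonneg _) (hM 0).1
  have hN : 1 < Module.finrank ℚ N := by rw [hNn]; exact hn₀
  set A₁ : ℝ := n₀ * A₀ with hA₁
  have hn2 : (2 : ℝ) ≤ n₀ := by exact_mod_cast hn₀
  have hA₁0 : 0 < A₁ := by positivity
  set Q : ℝ := ThornerZaman.condQn N with hQ
  have hQ12 : (12 : ℝ) ≤ Q := ThornerZaman.twelve_le_condQn (K := N) hN
  have hQ1 : (1 : ℝ) < Q := by linarith
  have hQ0 : (0 : ℝ) < Q := by linarith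
  have hlogQ : 2 ≤ Real.log Q := two_lt_log_twelve.le.trans (Real.log_le_log (by norm_num) hQ12)
  have hlogQ0 : 0 < Real.log Q := by linarith
  have hn₀Q : (n₀ : ℝ) ≤ Q := by rw [← hNn]; exact ThornerZaman.finrank_le_condQn (K := N)
  have hhQ : (n₀ : ℝ) ≤ Q ^ 4 := by
    have : Q ≤ Q ^ 4 := by
      have := pow_le_pow_right₀ hQ1.le (by norm_num : 1 ≤ 4); rwa [pow_one] at this
    linarith
  have ha₁1 : (1 : ℝ) ≤ a₁ := by linarith
  have hm0 : (0 : ℝ) < m := by exact_mod_cast hm1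
  -- domination of multiplicities and transfer of zeros
  have hdomE : ∀ ρ, analyticOrderNatAt (dedekindZeta₁ E) ρ ≤ analyticOrderNatAt (dedekindZeta₁ N) ρ :=
    fun ρ ↦ by rw [hord ρ]; exact Nat.le_add_right _ _
  have hdomj : ∀ j ∈ Finset.Ico 1 m, ∀ ρ, analyticOrderNatAt (L j) ρ ≤ analyticOrderNatAt (dedekindZeta₁ N) ρ := by
    intro j hj ρ
    rw [hord ρ]
    exact le_trans (Finset.single_le_sum (f := fun i ↦ analyticOrderNatAt (L i) ρ) (fun _ _ ↦ Nat.zero_le _) hj)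
      (Nat.le_add_left _ _)
  have hE2 : dedekindZeta₁ E 2 ≠ 0 := by
    rw [dedekindZeta₁_apply_eq_mul (by norm_num : 1 < (2 : ℂ).re)]
    exact mul_ne_zero (by norm_num) (NumberField.dedekindZeta_ne_zero_of_one_lt_re E (by norm_num))
  have hzeroE : ∀ ρ, famF E 0 ρ = 0 → dedekindZeta₁ N ρ = 0 := fun ρ h0 ↦
    eq_zero_of_analyticOrderNatAt_le (dedekindZeta₁_differentiable E) (dedekindZeta₁_differentiable N) hE2 hdomE
      (by rwa [famF_zero] at h0)
  have hzeroj : ∀ j ∈ Finset.Ico 1 m, ∀ ρ, L j ρ = 0 → dedekindZeta₁ N ρ = 0 := fun j hj ρ h0 ↦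
    dedekindZeta₁_eq_zero_of_dominated (hdata j).1 (hdata j).2.1 (hL j hj).1 (hL j hj).2 (hdomj j hj) h0
  -- `Q_E ≤ Q_N`
  have hQE : ThornerZaman.condQn E ≤ Q := by
    rw [hQ, ThornerZaman.condQn, ThornerZaman.condQn]
    have h1 : |(NumberField.discr E : ℝ)| ≤ |(NumberField.discr N : ℝ)| := by
      rw [← Int.cast_abs, ← Int.cast_abs, ← Nat.cast_natAbs, ← Nat.cast_natAbs]; exact_mod_cast hdE
    have hle : Module.finrank ℚ E ≤ Module.finrank ℚ N := by rw [hNn]; exact_mod_cast hnEn₀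
    have hleR : (Module.finrank ℚ E : ℝ) ≤ Module.finrank ℚ N := by exact_mod_cast hle
    have h1N : (1 : ℝ) ≤ Module.finrank ℚ N := by exact_mod_cast Module.finrank_pos (R := ℚ) (M := N)
    have h2 : (Module.finrank ℚ E : ℝ) ^ Module.finrank ℚ E ≤ (Module.finrank ℚ N : ℝ) ^ Module.finrank ℚ N :=
      (pow_le_pow_left₀ (Nat.cast_nonneg _) hleR _).trans (pow_le_pow_right₀ h1N hle)
    exact mul_le_mul h1 h2 (by positivity) (abs_nonneg _)
  -- sizes of the conductors: `log A_j ≤ Q − 1`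
  obtain ⟨-, hlogdN⟩ := log_natAbs_discr_mem N
  have hlA : ∀ j ∈ Finset.Ico 1 m, 0 ≤ Real.log (|(discr E : ℝ)| * (Ideal.absNorm (𝔣 j) : ℝ)) ∧
      Real.log (|(discr E : ℝ)| * (Ideal.absNorm (𝔣 j) : ℝ)) ≤ Q - 1 := by
    intro j hj
    have h1 : (1 : ℝ) ≤ |(discr E : ℝ)| := by
      have := Int.one_le_abs (discr_ne_zero E)
      rw [← Int.cast_abs]; exact_mod_cast this
    have h2 : (1 : ℝ) ≤ (Ideal.absNorm (𝔣 j) : ℝ) := by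
      exact_mod_cast Nat.one_le_iff_ne_zero.mpr (by rw [ne_eq, Ideal.absNorm_eq_zero_iff]; exact (hdata j).1)
    have hA1 : (1 : ℝ) ≤ |(discr E : ℝ)| * (Ideal.absNorm (𝔣 j) : ℝ) := by nlinarith
    refine ⟨Real.log_nonneg hA1, ?_⟩
    have := Real.log_le_log (by linarith) (hcond j hj)
    rw [← hQ] at hlogdN; linarith
  have hxa₀ : Q ^ a₀ ≤ x := le_trans (Real.rpow_le_rpow_of_exponent_le hQ1.le ha₁a₀) hx
  have hxQ : Q ≤ x := by
    have : Q ^ (1 : ℝ) ≤ Q ^ a₁ := Real.rpow_le_rpow_of_exponent_le hQ1.le ha₁1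
    rw [Real.rpow_one] at this; linarith
  have hx1 : 1 < x := by linarith
  have hx0 : 0 < x := by linarith
  set Lx : ℝ := Real.log x with hLx
  have hLQ : a₁ * Real.log Q ≤ Lx := by
    have := Real.log_le_log (by positivity) hx
    rwa [Real.log_rpow (by linarith)] at this
  have hL2a : 2 * a₁ ≤ Lx := by nlinarith
  have hL64 : 64 ≤ Lx := by nlinarith
  have hL0 : 0 < Lx := by linarith
  have hL1 : 1 ≤ Lx := by linarith
  have hQexp : Q ≤ Real.exp (Lx / 8) := by
    refine le_exp_of_log_le (by linarith) ?_
    rw [le_div_iff₀ (by norm_num)]; nlinarith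
  have hQexpE : ThornerZaman.condQn E ≤ Real.exp (Lx / 8) := hQE.trans hQexp
  set ε : ℝ := x ^ (-ν) with hε
  have hε0 : 0 < ε := Real.rpow_pos_of_pos hx0 _
  have hε1 : ε ≤ 1 := Real.rpow_le_one_of_one_le_of_nonpos hx1.le (by linarith)
  have hεL : ε < Lx / 2 := by linarith
  have hεexp : ε = Real.exp (-(ν * Lx)) := by
    rw [hε, Real.rpow_def_of_pos hx0, ← hLx]; ring_nf
  set g := tzTest Lx ε with hg
  -- the zero sum of `ζ₁_N` off the exceptional segment
  set BN : ℝ := A₀ * x * (Real.exp (-(cZ * Real.log x / (4 * a * Real.log (ThornerZaman.condQn N)))) +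
      Real.exp (-Real.sqrt (cZ * Real.log x / 4))) + A₀ * x ^ (1 - ν) with hBN
  have hBζ : ∀ u : Finset ℂ, (∀ ρ ∈ u, dedekindZeta₁ N ρ = 0 ∧ 0 < ρ.re ∧ ρ.re < 1) →
      ∑ ρ ∈ u with ¬ excRegion c N ρ, (analyticOrderNatAt (dedekindZeta₁ N) ρ : ℝ) * ‖fordLaplace g (-ρ)‖ ≤ BN := by
    intro u hu
    have h := hZ N hNn hdens x hxa₀ cZ hcZ hzfr ε le_rfl hε1
      (fun ψ ↦ if ψ = 0 then u else ∅) (fun ψ ρ hρ ↦ by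
        by_cases hψ : ψ = 0
        · subst hψ; simp only [if_true] at hρ; rw [famF_zero]; exact hu ρ hρ
        · simp [hψ] at hρ)
    rw [Finset.sum_eq_single (0 : AddChar (Additive (ClassGroup (𝓞 N))) ℂ)] at h
    · simp only [if_true, famMult, famF_zero] at h
      exact h
    · intro ψ _ hψ; rw [if_neg hψ]; simp
    · intro h0; exact absurd (Finset.mem_univ _) h0
  -- (a) the characters `χ_j`, `0 < j < m`
  have hBj : ∀ j ∈ Finset.Ico 1 m, ∀ u : Finset ℂ, (∀ ρ ∈ u, L j ρ = 0 ∧ 0 < ρ.re ∧ ρ.re < 1) →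
      ∑ ρ ∈ u with ρ ∉ Exc j, (analyticOrderNatAt (dedekindZeta₁ N) ρ : ℝ) * ‖fordLaplace g (-ρ)‖ ≤ BN := by
    intro j hj u hu
    have hu' : ∀ ρ ∈ u, dedekindZeta₁ N ρ = 0 ∧ 0 < ρ.re ∧ ρ.re < 1 :=
      fun ρ hρ ↦ ⟨hzeroj j hj ρ (hu ρ hρ).1, (hu ρ hρ).2⟩
    refine le_trans (Finset.sum_le_sum_of_subset_of_nonneg (fun ρ hρ ↦ ?_)
      (fun ρ _ _ ↦ mul_nonneg (Nat.cast_nonneg _) (norm_nonneg _))) (hBζ u hu')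
    rw [Finset.mem_filter] at hρ ⊢
    refine ⟨hρ.1, fun hexc ↦ hρ.2 ?_⟩
    exact (hExc' ρ (hu' ρ hρ.1).1 (hu ρ hρ.1).2.1 (hu ρ hρ.1).2.2 hexc).2 j hj (hu ρ hρ.1).1
  have hKj : ∀ j ∈ Finset.Ico 1 m,
      ‖coefFordK (rcCoef (𝔣 j) (χ j)) g 0 +
          ∑ ρ ∈ Exc j, (analyticOrderNatAt (L j) ρ : ℂ) * fordLaplace g (-ρ)‖ ≤ BN + (1152 * Real.exp (Lx / 4) + CJ) := by
    intro j hj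
    obtain ⟨h𝔣, hray, hprim, hsig⟩ := hdata j
    have h := norm_coefFordK_rcCoef_add_exc_le_of_zeros hray hprim hsig h𝔣 (hnt j hj) (hL j hj).1 (hL j hj).2
      (hL' j hj).1 (hL' j hj).2 (hdomj j hj) hCr0 hCr hM hx1 hε0 hεL (Exc j) (hExcj j hj) (hBj j hj)
    obtain ⟨hlA0, hlAQ⟩ := hlA j hj
    have hnE0 : (0 : ℝ) ≤ Module.finrank ℚ E := Nat.cast_nonneg _
    have hnEQ : (Module.finrank ℚ E : ℝ) ≤ Q := hnEn₀.trans hn₀Q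
    have h1 := rayClass_trivialZero_junk_le hlA0 hlAQ hnEQ hQexp hL1 hε0.le hε1
    have h2 := rayClass_leftLine_junk_le (n₀ := (n₀ : ℝ)) hCr0 hM0 hlA0 hlAQ hnEn₀ hnE0 hQ12 hQexp hL0 hε0 hε1 hν64 hεexp
    have h3 : 8 * NumberField.leftLineConst * Cr * (n₀ + 1) * M ≤ CJ := hCJCr
    linarith
  -- (b) the trivial character: `ζ₁_E`
  have hB0 : ∀ u : Finset ℂ, (∀ ρ ∈ u, famF E 0 ρ = 0 ∧ 0 < ρ.re ∧ ρ.re < 1) →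
      ∑ ρ ∈ u with ρ ∉ Exc 0, (famMult E 0 ρ : ℝ) * ‖fordLaplace g (-ρ)‖ ≤ BN := by
    intro u hu
    have hu' : ∀ ρ ∈ u, dedekindZeta₁ N ρ = 0 ∧ 0 < ρ.re ∧ ρ.re < 1 :=
      fun ρ hρ ↦ ⟨hzeroE ρ (hu ρ hρ).1, (hu ρ hρ).2⟩
    refine le_trans (Finset.sum_le_sum fun ρ _ ↦ ?_) (le_trans (Finset.sum_le_sum_of_subset_of_nonneg
      (fun ρ hρ ↦ ?_) (fun ρ _ _ ↦ mul_nonneg (Nat.cast_nonneg _) (norm_nonneg _))) (hBζ u hu'))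
    · exact mul_le_mul_of_nonneg_right (by rw [famMult, famF_zero]; exact_mod_cast hdomE ρ) (norm_nonneg _)
    · rw [Finset.mem_filter] at hρ ⊢
      refine ⟨hρ.1, fun hexc ↦ hρ.2 ?_⟩
      exact (hExc' ρ (hu' ρ hρ.1).1 (hu ρ hρ.1).2.1 (hu ρ hρ.1).2.2 hexc).1 (hu ρ hρ.1).1
  have hK0 : ‖coefFordK (rcCoef (𝔣 0) (χ 0)) g 0 - fordLaplace g (-1) +
      ∑ ρ ∈ Exc 0, (famMult E 0 ρ : ℂ) * fordLaplace g (-ρ)‖ ≤ BN + (1152 * Real.exp (Lx / 4) + CJ) := by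
    have hχ0' : χ 0 = fun _ ↦ (1 : ℂ) := funext hχ0
    have hM₀ : (famMult E 0 0 : ℝ) * (Lx + ε) ≤ 1152 * Real.exp (Lx / 4) :=
      famMult_zero_term_le_all E 0 hL1 hε0.le hε1 hQexpE
    have hJ0 : ‖dzEFRemainder E (tzTest Lx ε) 0‖ ≤ 8 * leftLineConst * Al * (Module.finrank ℚ E + 1) * M :=
      leftLine_term_le_one_all hAl0 hAl hM E (by linarith) hε0 hεL hε1 hν64 hεexp hQexpE
    have hJ0' : ‖dzEFRemainder E (tzTest Lx ε) 0‖ ≤ CJ := by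
      refine hJ0.trans (le_trans ?_ hCJAl)
      have h2 : (Module.finrank ℚ E : ℝ) + 1 ≤ n₀ + 1 := by linarith
      exact mul_le_mul_of_nonneg_right (mul_le_mul_of_nonneg_left h2 (by positivity)) hM0
    have h := norm_coefFordK_famF_sub_le (K := E) 0 hx1 hε0 hεL (Exc 0) hExc0 hB0 hM₀
      (fun _ ↦ hJ0') (fun h ↦ absurd rfl h)
    simp only [if_true] at h
    rw [h𝔣0, hχ0', rcCoef_top_one_eq]
    linarith
  -- (c) summing over `j < m` with `|c^j| ≤ 1`
  have hcpow : ∀ j, ‖cc ^ j‖ ≤ 1 := fun j ↦ by rw [norm_pow]; exact pow_le_one₀ (norm_nonneg _) hcc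
  have hsplit : ∑ j ∈ Finset.range m, cc ^ j * coefFordK (rcCoef (𝔣 j) (χ j)) g 0 - fordLaplace g (-1) +
      (∑ ρ ∈ Exc 0, (famMult E 0 ρ : ℂ) * fordLaplace g (-ρ) +
        ∑ j ∈ Finset.Ico 1 m, cc ^ j * ∑ ρ ∈ Exc j, (analyticOrderNatAt (L j) ρ : ℂ) * fordLaplace g (-ρ)) =
      (coefFordK (rcCoef (𝔣 0) (χ 0)) g 0 - fordLaplace g (-1) +
        ∑ ρ ∈ Exc 0, (famMult E 0 ρ : ℂ) * fordLaplace g (-ρ)) +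
      ∑ j ∈ Finset.Ico 1 m, cc ^ j * (coefFordK (rcCoef (𝔣 j) (χ j)) g 0 +
        ∑ ρ ∈ Exc j, (analyticOrderNatAt (L j) ρ : ℂ) * fordLaplace g (-ρ)) := by
    rw [Finset.range_eq_Ico, Finset.sum_eq_sum_Ico_succ_bot hm1, pow_zero, one_mul]
    simp only [mul_add, Finset.sum_add_distrib]
    ring
  have hmain : ‖∑ j ∈ Finset.range m, cc ^ j * coefFordK (rcCoef (𝔣 j) (χ j)) g 0 - fordLaplace g (-1) +
      (∑ ρ ∈ Exc 0, (famMult E 0 ρ : ℂ) * fordLaplace g (-ρ) +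
        ∑ j ∈ Finset.Ico 1 m, cc ^ j * ∑ ρ ∈ Exc j, (analyticOrderNatAt (L j) ρ : ℂ) * fordLaplace g (-ρ))‖ ≤
      m * (BN + (1152 * Real.exp (Lx / 4) + CJ)) := by
    rw [hsplit]
    refine (norm_add_le _ _).trans ?_
    have h2 : ‖∑ j ∈ Finset.Ico 1 m, cc ^ j * (coefFordK (rcCoef (𝔣 j) (χ j)) g 0 +
        ∑ ρ ∈ Exc j, (analyticOrderNatAt (L j) ρ : ℂ) * fordLaplace g (-ρ))‖ ≤
        ∑ j ∈ Finset.Ico 1 m, (BN + (1152 * Real.exp (Lx / 4) + CJ)) := by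
      refine (norm_sum_le _ _).trans (Finset.sum_le_sum fun j hj ↦ ?_)
      rw [norm_mul]
      calc ‖cc ^ j‖ * ‖coefFordK (rcCoef (𝔣 j) (χ j)) g 0 + ∑ ρ ∈ Exc j, (analyticOrderNatAt (L j) ρ : ℂ) * fordLaplace g (-ρ)‖
          ≤ 1 * (BN + (1152 * Real.exp (Lx / 4) + CJ)) :=
            mul_le_mul (hcpow j) (hKj j hj) (norm_nonneg _) zero_le_one
        _ = _ := one_mul _
    rw [Finset.sum_const, Nat.card_Ico, nsmul_eq_mul] at h2
    have hm' : ((m - 1 : ℕ) : ℝ) = m - 1 := by rw [Nat.cast_sub hm1, Nat.cast_one]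
    rw [hm'] at h2
    have hBN0 : 0 ≤ BN + (1152 * Real.exp (Lx / 4) + CJ) := by
      have : 0 ≤ BN := by rw [hBN]; positivity
      positivity
    nlinarith [hK0, h2]
  have hjunk : A₁ * x ^ (1 - ν) + (n₀ : ℝ) * (1152 * Real.exp (Lx / 4) + CJ) ≤ η / 4 * x * (c₁ * Q ^ (-(2 : ℝ))) :=
    junk_small hA₁0 hCJ0 hQ12 hhQ hν0 hν64 hη hc₁ hx ha₁32 (by rw [hA₁]; exact ha₁J)
  refine hmain.trans ?_
  have e : (m : ℝ) * (BN + (1152 * Real.exp (Lx / 4) + CJ)) =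
      m * (A₀ * x * (Real.exp (-(cZ * Lx / (4 * a * Real.log Q))) + Real.exp (-Real.sqrt (cZ * Lx / 4)))) +
        (m * (A₀ * x ^ (1 - ν)) + m * (1152 * Real.exp (Lx / 4) + CJ)) := by rw [hBN, hQ, hLx]; ring
  rw [e]
  have hE1 : (m : ℝ) * (A₀ * x * (Real.exp (-(cZ * Lx / (4 * a * Real.log Q))) + Real.exp (-Real.sqrt (cZ * Lx / 4)))) ≤
      x * (A₁ * (Real.exp (-(cZ * Lx / (4 * a * Real.log Q))) + Real.exp (-Real.sqrt (cZ * Lx / 4)))) := by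
    rw [hA₁]
    have h0 : 0 ≤ A₀ * x * (Real.exp (-(cZ * Lx / (4 * a * Real.log Q))) + Real.exp (-Real.sqrt (cZ * Lx / 4))) := by
      positivity
    nlinarith
  have hE2 : (m : ℝ) * (A₀ * x ^ (1 - ν)) ≤ A₁ * x ^ (1 - ν) := by
    rw [hA₁]; have : 0 ≤ A₀ * x ^ (1 - ν) := by positivity
    nlinarith
  have hE3 : (m : ℝ) * (1152 * Real.exp (Lx / 4) + CJ) ≤ n₀ * (1152 * Real.exp (Lx / 4) + CJ) :=
    mul_le_mul_of_nonneg_right hmn₀ (by positivity)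
  linarith

end Summit.QuantumAdvantage.QuantumAdvantage.Theorems.DegreeOnePrimesEscape
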